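import Literature.Topology.FourManifolds.HomotopySpheresSignatureLemma74Closed
import HarnessLib

/-!
# Kervaire–Milnor's Lemma 7.4 split at Milnor–Kervaire [18]: the existence of closed almost
# parallelizable `4m`-manifolds with non-zero signature, as a named fact

Topic `Literature/Topology/FourManifolds`. SPLIT RECORD (fact-decompose, 2026-08-16) of the named
fact `Literature.Topology.FourManifolds.HomotopySphere.exists_mem_signatureSet_sphere_ne_zero`
(`HomotopySpheresSignature.lean`; M. Kervaire, J. Milnor, *Groups of homotopy spheres: I*, Ann. of
Math. (2) 77 (1963), **Lemma 7.4**, p. 529: "For each `k = 2m` there exists a parallelizable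
manifold `M₀` whose boundary `bM₀` is the ordinary `(4m-1)`-sphere, such that the signature `σ(M₀)`
is non-zero"). The printed proof is two sentences: "According to Milnor and Kervaire [18, p. 457]
there exists a closed 'almost parallelizable' `4m`-manifold whose signature is non-zero. Removing
the interior of an imbedded `4m`-disk from this manifold, we obtain the required parallelizable
manifold `M₀`." The second sentence is PROVED in the tree in full (`HomotopySpheresSignatureLemma74Closed.lean`:
`exists_mem_signatureSet_sphere_ne_zero_of_milnorKervaire1958_stable`, disc removal, Lemma 3.4,
invariance of the signature), with [18] as an inline hypothesis in its weakest (stable) form. This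
file vendors that hypothesis — the theorem of J. Milnor, M. Kervaire, *Bernoulli numbers, homotopy
groups, and a theorem of Rohlin*, Proc. ICM Edinburgh 1958 (CUP 1960), p. 457 — as the named fact
`MilnorKervaire1958_exists_almostParallelizable_signature_ne_zero`, and records the assembly
`exists_mem_signatureSet_sphere_ne_zero_holds_of`.

The child is the entire remaining content of Lemma 7.4 (hence, with Thm. 7.5, of the finiteness /
cyclicity of `bP₄ₘ`, Cor. 7.6, on this input): its printed proof needs Bott periodicity
(`π_{4m-1}(SO) ≅ ℤ` and the Pontryagin class of the corresponding bundle over `S⁴ᵐ`), the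
finiteness of the stable stems (Serre) so that `ker J_{4m-1}` is non-trivial, the Pontryagin–Thom
construction, and Hirzebruch's signature theorem — none of which is in the tree; `m = 1` is the
K3 surface. It does not restate the parent (closed manifolds and stable framings off a point,
versus bounded parallelizable manifolds and `signatureSet`).

## References

* [KervaireMilnorAnnals1963] M. A. Kervaire, J. W. Milnor, Groups of homotopy spheres: I, Ann. of
  Math. (2) 77 (1963) 504–537: Lemma 7.4 and its proof (p. 529), p. 530 (almost parallelizable),
  Lemma 3.4 (p. 509).
* [MilnorKervaireICM1958] J. W. Milnor, M. A. Kervaire, Bernoulli numbers, homotopy groups, and a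
  theorem of Rohlin, Proc. ICM 1958 (CUP 1960) 454–458, p. 457.
-/

open scoped Manifold ContDiff Topology
open Set Function

noncomputable section

namespace Literature.Topology.FourManifolds

open Literature.AlgebraicTopology.SingularHomology

namespace HomotopySphere

/-- **Milnor–Kervaire 1958 [18, p. 457] (as quoted in the proof of Kervaire–Milnor's Lemma 7.4,
Ann. of Math. 77 (1963), p. 529): for every `m ≥ 1` there is a closed almost parallelizable
`4m`-manifold whose signature is non-zero.** Rendered in the tree's language, in the STABLE form in
which the Pontryagin–Thom construction delivers it (Kosinski IX.8.7) and which Lemma 7.4 consumes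
(`exists_mem_signatureSet_sphere_ne_zero_of_milnorKervaire1958_stable`): for `n + 1 = 4m`, `m ≥ 1`,
there are a compact connected Hausdorff second-countable smooth `(n+1)`-manifold `X : Type`
(modelled on `EuclideanSpace ℝ (Fin (n + 1))`, boundaryless), a point `x₀` such that `TX ⊕ ℝ` is
framed over the complement of `x₀` (`HasStableTangentFramingAlong … (Subtype.val : {x₀}ᶜ → X)`,
"almost parallelizable" p. 530 in stable form — implied by the unstable wording,
`milnorKervaire1958_stable_of_unstable`), and a homological orientation `μ` of `X` with
`σ(X, μ) ≠ 0` (`HomologicalOrientation.signatureInDim` in the middle dimension `2m`). Printed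
proof ([18]): a generator of `π_{4m-1}(SO)` (Bott) has a non-zero multiple in `ker J` (finiteness of
the stable stems), the Pontryagin–Thom construction turns it into a closed manifold framed off a
disc with `p_m ≠ 0` and `p_i = 0` (`i < m`), whose signature is a non-zero multiple of `p_m[X]` by
Hirzebruch's signature theorem; for `m = 1`, the K3 surface. NOT proved in the tree.
[cite: MilnorKervaireICM1958, p. 457] [cite: KervaireMilnorAnnals1963, proof of Lemma 7.4 (p. 529) and p. 530] -/
def MilnorKervaire1958_exists_almostParallelizable_signature_ne_zero : Prop :=
  ∀ (n m : ℕ) (_ : n + 1 = 4 * m), 1 ≤ m →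
    ∃ (X : Type) (_ : TopologicalSpace X) (_ : T2Space X) (_ : SecondCountableTopology X)
      (_ : CompactSpace X) (_ : ConnectedSpace X)
      (_ : ChartedSpace (EuclideanSpace ℝ (Fin (n + 1))) X) (_ : IsManifold (𝓡 (n + 1)) ∞ X)
      (x₀ : X) (μ : HomologicalOrientation ℤ X (n + 1)),
      HasStableTangentFramingAlong (𝓡 (n + 1)) X (Subtype.val : ↥({x₀}ᶜ : Set X) → X) ∧
        μ.signatureInDim (show 2 * m + 2 * m = n + 1 by omega) ≠ 0

/-- **Assembly of the split: Kervaire–Milnor's Lemma 7.4 from Milnor–Kervaire [18].** The named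
fact `exists_mem_signatureSet_sphere_ne_zero` follows from its single open child
`MilnorKervaire1958_exists_almostParallelizable_signature_ne_zero`; the disc removal ("Removing
the interior of an imbedded `4m`-disk …") is the tree's
`exists_mem_signatureSet_sphere_ne_zero_of_milnorKervaire1958_stable`.
[cite: KervaireMilnorAnnals1963, Lemma 7.4 and its proof (p. 529)] -/
theorem exists_mem_signatureSet_sphere_ne_zero_holds_of
    (h : MilnorKervaire1958_exists_almostParallelizable_signature_ne_zero) :
    exists_mem_signatureSet_sphere_ne_zero :=
  exists_mem_signatureSet_sphere_ne_zero_of_milnorKervaire1958_stable h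

/-- The classical (unstable) wording of [18] — `TX` itself framed off a point — implies the child
(`milnorKervaire1958_stable_of_unstable`), so the child is the WEAKER of the two printed readings.
[cite: KervaireMilnorAnnals1963, p. 530 (almost parallelizable)] -/
theorem MilnorKervaire1958_exists_almostParallelizable_signature_ne_zero.of_unstable
    (H : ∀ (n m : ℕ) (_ : n + 1 = 4 * m), 1 ≤ m →
      ∃ (X : Type) (_ : TopologicalSpace X) (_ : T2Space X) (_ : SecondCountableTopology X)
        (_ : CompactSpace X) (_ : ConnectedSpace X)
        (_ : ChartedSpace (EuclideanSpace ℝ (Fin (n + 1))) X) (_ : IsManifold (𝓡 (n + 1)) ∞ X)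
        (x₀ : X) (μ : HomologicalOrientation ℤ X (n + 1)),
        HasTangentFramingAlong (𝓡 (n + 1)) X (Subtype.val : ↥({x₀}ᶜ : Set X) → X) ∧
          μ.signatureInDim (show 2 * m + 2 * m = n + 1 by omega) ≠ 0) :
    MilnorKervaire1958_exists_almostParallelizable_signature_ne_zero :=
  fun n m h hm ↦ milnorKervaire1958_stable_of_unstable H n m h hm

end HomotopySphere

end Literature.Topology.FourManifolds

end
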